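import Summits.Ventures.PercRepro.ProfilePointedCircuitClassesFourteenSparse
import Summits.Ventures.PercRepro.ProfilePointedCircuitClassesSevenE
import Summits.Ventures.PercRepro.ProfilePointedCircuitClassesInOutSeries

/-!
# PercRepro — THE SERIES-PAIR REDUCTION OF THE TWELVE-POINT STATEMENT, I: THE SERIES-PAIR FACTS AND THE TWO MINORS
(p5, gen 44; `proofs/P5-GM1.md` §66)

`InOutBottomTwelve` asks `in_5(e) ≤ out_6(e)` on every matroid `N` with `12` points and rank `7`.  Let `{a, a'}` be a
SERIES PAIR of `N` (a 2-cocircuit: `ρ(E − a) = ρ(E − a') = ρ(E)`, `ρ(E − a − a') + 1 = ρ(E)`; in the dual `N✶` the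
points `a, a'` are PARALLEL) with `e ∉ {a, a'}`.  Then
* no bi-independent `5`-set contains both `a` and `a'` (its complement is a basis inside `E − a − a'`), the swap
  `W ↦ W − a + a'` is a bijection between the bi-independent sets containing exactly one of them
  (`swap_mem_biIndepSets_of_seriesPair`: `a, a' ∉ cl(Y)` for every `Y ⊆ E − a − a'`),
* the sets avoiding `a, a'` are bi-independent in `N` iff in `N ／ a` (`mem_biIndepSets_contract_iff_of_seriesPair`),
  the sets `W ∋ a'` of `N ／ a` lift to `W + a` in `N` (`…_iff_insert_of_seriesPair`), and the sets of the `10`-point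
  minor `N₁ := N ／ a ∖ a'` lift to `Y + a` / `Y + a'` in `N` (`mem_biIndepSets_minor_iff_insert_left_of_seriesPair`).
Writing `N' := N ／ a` (`11` points, rank `6`) and `f := a'`, the counts decompose as
`in_5(e) = d₀ + 2·d₁` and `out_6(e) = u₀ + 2·u₁ + u₂` with `d₁ = in_4^{N₁}(e) ≤ out_5^{N₁}(e) = u₁` (the `n = 10`
theorem `inOutBottomFour_holds`), `d₀ = #{W ∈ BI_5(N') : e ∈ W, f ∉ W}`, `u₂ = #{W ∈ BI_5(N') : f ∈ W, e ∉ W}` and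
`u₀ = #{W ∈ BI_5(N') : e, f ∈ W}` (complementation in `N'`).  HENCE (`inCount_five_le_outCount_six_of_seriesPair_of_star`, in ProfilePointedCircuitClassesTwelveSeriesB)
the twelve-point statement at `(N, e)` follows from the `11`-POINT TWO-POINT INEQUALITY
`in_5^{N'}(e) ≤ in_5^{N'}(f) + thru_5^{N'}({e, f})` — the statement `(★)` of §66, census-clean (0 failures on
≈ 60,000 ordered pairs), an identity when `f` has a series twin in `N'` (ProfilePointedCircuitClassesTwelveSeriesC).
-/

open scoped Matroid

namespace PercRepro.Cogirth

open Finset ThmH Skew Shadow Profile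

variable {α : Type} [DecidableEq α] {N : Matroid α} [N.Finite]

section TwelveSeriesA

/-- A SERIES PAIR `{a, a'}` of `N` (a 2-cocircuit): two distinct non-coloops of `E` whose joint deletion drops the
rank: `ρ(E − a) = ρ(E − a') = ρ(E)` and `ρ(E − a − a') + 1 = ρ(E)`. -/
def SeriesPair (N : Matroid α) [N.Finite] (a a' : α) : Prop :=
  a ∈ gr N ∧ a' ∈ gr N ∧ a ≠ a' ∧ rk N ((gr N).erase a) = rk N (gr N) ∧
    rk N ((gr N).erase a') = rk N (gr N) ∧ rk N (((gr N).erase a).erase a') + 1 = rk N (gr N)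

/-- A series pair is symmetric. -/
theorem SeriesPair.symm {a a' : α} (h : SeriesPair N a a') : SeriesPair N a' a := by
  obtain ⟨ha, ha', hne, hca, hca', hser⟩ := h
  exact ⟨ha', ha, hne.symm, hca', hca, by rw [erase_right_comm]; exact hser⟩

/-- `a ∉ cl(Y)` for every `Y ⊆ E − a − a'`: `ρ(Y + a) = ρ(Y) + 1` (`cl(E − a − a')` is a hyperplane avoiding `a`). -/
theorem rk_insert_left_eq_add_one_of_seriesPair {a a' : α} (h : SeriesPair N a a') {Y : Finset α}
    (hY : Y ⊆ ((gr N).erase a).erase a') : rk N (insert a Y) = rk N Y + 1 := by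
  obtain ⟨ha, ha', hne, hca, hca', hser⟩ := h
  refine rk_insert_eq_add_one_of_subset ha hY ((erase_subset _ _).trans (erase_subset _ _)) ?_
  rw [insert_erase_erase_eq_erase ha hne, hca']
  omega

/-- `a' ∉ cl(Y)` for every `Y ⊆ E − a − a'`: `ρ(Y + a') = ρ(Y) + 1`. -/
theorem rk_insert_right_eq_add_one_of_seriesPair {a a' : α} (h : SeriesPair N a a') {Y : Finset α}
    (hY : Y ⊆ ((gr N).erase a).erase a') : rk N (insert a' Y) = rk N Y + 1 := by
  apply rk_insert_left_eq_add_one_of_seriesPair h.symm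
  rw [erase_right_comm]
  exact hY

/-- A point of a series pair is not a loop. -/
theorem rk_singleton_eq_one_of_seriesPair {a a' : α} (h : SeriesPair N a a') : rk N {a} = 1 := by
  have h1 := rk_insert_left_eq_add_one_of_seriesPair h (Y := ∅) (empty_subset _)
  have h0 : rk N ∅ = 0 := Nat.le_zero.1 ((rk_le_card (M := N) ∅).trans (by rw [card_empty]))
  rw [insert_empty] at h1
  omega

/-- A point of a series pair is independent (as a set). -/
theorem indep_singleton_of_seriesPair {a a' : α} (h : SeriesPair N a a') : N.Indep ({a} : Set α) := by
  have := indep_of_rk_eq_card' (M := N) (X := {a})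
    (by rw [rk_singleton_eq_one_of_seriesPair h, card_singleton])
  simpa using this

/-- **THE SWAP**: for a bi-independent `k`-set `W ∋ a` with `a' ∉ W`, the set `W − a + a'` is bi-independent
(`ρ(W − a + a') = ρ(W − a) + 1 = ρ(W)` and `ρ((E ∖ W) − a' + a) = ρ((E ∖ W) − a') + 1 = ρ(E ∖ W)`). -/
theorem swap_mem_biIndepSets_of_seriesPair {a a' : α} (h : SeriesPair N a a') {k : ℕ} {W : Finset α}
    (hW : W ∈ biIndepSets N k) (haW : a ∈ W) (ha'W : a' ∉ W) :
    insert a' (W.erase a) ∈ biIndepSets N k := by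
  obtain ⟨hWg, hWc, hWr, hWcompl⟩ := mem_biIndepSets.1 hW
  have ha : a ∈ gr N := h.1
  have ha' : a' ∈ gr N := h.2.1
  have hne : a ≠ a' := h.2.2.1
  have hY : W.erase a ⊆ ((gr N).erase a).erase a' := by
    intro y hy
    rw [mem_erase] at hy
    exact mem_erase.2 ⟨fun hy' => ha'W (hy' ▸ hy.2), mem_erase.2 ⟨hy.1, hWg hy.2⟩⟩
  have ha'Y : a' ∉ W.erase a := fun h' => ha'W (mem_of_mem_erase h')
  have ha'c : a' ∈ gr N \ W := mem_sdiff.2 ⟨ha', ha'W⟩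
  have hZ : (gr N \ W).erase a' ⊆ ((gr N).erase a).erase a' := by
    intro y hy
    rw [mem_erase, mem_sdiff] at hy
    exact mem_erase.2 ⟨hy.1, mem_erase.2 ⟨fun hya => hy.2.2 (hya ▸ haW), hy.2.1⟩⟩
  have haZ : a ∉ (gr N \ W).erase a' := fun h' => (mem_sdiff.1 (mem_of_mem_erase h')).2 haW
  have hcompl : gr N \ insert a' (W.erase a) = insert a ((gr N \ W).erase a') := by
    ext y
    simp only [mem_sdiff, mem_insert, mem_erase, not_or, not_and]
    constructor
    · rintro ⟨hyg, hya', hyW⟩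
      by_cases hya : y = a
      · exact Or.inl hya
      · exact Or.inr ⟨hya', hyg, hyW hya⟩
    · rintro (rfl | ⟨hya', hyg, hyW⟩)
      · exact ⟨ha, hne, fun hya => absurd rfl hya⟩
      · exact ⟨hyg, hya', fun _ => hyW⟩
  have hWpos : 1 ≤ W.card := card_pos.2 ⟨a, haW⟩
  have hcpos : 1 ≤ (gr N \ W).card := card_pos.2 ⟨a', ha'c⟩
  rw [mem_biIndepSets]
  refine ⟨insert_subset ha' ((erase_subset _ _).trans hWg), ?_, ?_, ?_⟩
  · rw [card_insert_of_notMem ha'Y, card_erase_of_mem haW]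
    omega
  · rw [rk_insert_right_eq_add_one_of_seriesPair h hY, card_insert_of_notMem ha'Y, card_erase_of_mem haW]
    have h1 := rk_insert_left_eq_add_one_of_seriesPair h hY
    rw [insert_erase haW] at h1
    omega
  · rw [hcompl, rk_insert_left_eq_add_one_of_seriesPair h hZ, card_insert_of_notMem haZ,
      card_erase_of_mem ha'c]
    have h2 := rk_insert_right_eq_add_one_of_seriesPair h hZ
    rw [insert_erase ha'c] at h2
    omega

/-- Swapping `a` for `a'` and back: `W + a` is bi-independent iff `W + a'` is (`a, a' ∉ W`). -/
theorem insert_left_mem_biIndepSets_iff_insert_right_of_seriesPair {a a' : α} (h : SeriesPair N a a')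
    {k : ℕ} {Y : Finset α} (haY : a ∉ Y) (ha'Y : a' ∉ Y) :
    insert a Y ∈ biIndepSets N k ↔ insert a' Y ∈ biIndepSets N k := by
  constructor
  · intro hW
    have := swap_mem_biIndepSets_of_seriesPair h hW (mem_insert_self a Y)
      (by rw [mem_insert, not_or]; exact ⟨h.2.2.1.symm, ha'Y⟩)
    rwa [erase_insert haY] at this
  · intro hW
    have := swap_mem_biIndepSets_of_seriesPair h.symm hW (mem_insert_self a' Y)
      (by rw [mem_insert, not_or]; exact ⟨h.2.2.1, haY⟩)
    rwa [erase_insert ha'Y] at this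

/-- A bi-independent `k`-set of `N` contains at most one point of a series pair when `#E = ρ(E) + k`: its complement is
a basis, which cannot lie in the hyperplane `E − a − a'`. -/
theorem not_mem_of_mem_biIndepSets_of_seriesPair {a a' : α} (h : SeriesPair N a a') {k : ℕ}
    (hn : (gr N).card = rk N (gr N) + k) {W : Finset α} (hW : W ∈ biIndepSets N k) (haW : a ∈ W) :
    a' ∉ W := by
  intro ha'W
  obtain ⟨hWg, hWc, hWr, hWcompl⟩ := mem_biIndepSets.1 hW
  have hsub : gr N \ W ⊆ ((gr N).erase a).erase a' := by
    intro y hy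
    rw [mem_sdiff] at hy
    exact mem_erase.2 ⟨fun hy' => hy.2 (hy' ▸ ha'W), mem_erase.2 ⟨fun hy' => hy.2 (hy' ▸ haW), hy.1⟩⟩
  have h1 := rk_mono' (M := N) hsub
  have h2 : (gr N \ W).card = rk N (gr N) := by
    rw [card_sdiff_of_subset hWg, hn, hWc]
    omega
  have hser := h.2.2.2.2.2
  omega

/-! ### The sets avoiding `a, a'`: bi-independence in `N` and in `N ／ a` agree -/

/-- Bi-independence in `N ／ a` of a set avoiding `a, a'` is bi-independence in `N`
(`ρ_{N／a}(W) = ρ_N(W + a) − 1 = ρ_N(W)`, and the complements differ by the point `a`). -/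
theorem mem_biIndepSets_contract_iff_of_seriesPair {a a' : α} (h : SeriesPair N a a') {k : ℕ}
    {W : Finset α} (hW : W ⊆ (gr N).erase a) (ha'W : a' ∉ W) :
    W ∈ biIndepSets (N ／ ({a} : Set α)) k ↔ W ∈ biIndepSets N k := by
  have ha : a ∈ gr N := h.1
  have hind := indep_singleton_of_seriesPair h
  have hgr : gr (N ／ ({a} : Set α)) = (gr N).erase a := gr_contract'
  have haW : a ∉ W := fun h' => (mem_erase.1 (hW h')).1 rfl
  have hY : W ⊆ ((gr N).erase a).erase a' :=
    fun y hy => mem_erase.2 ⟨fun h' => ha'W (h' ▸ hy), hW hy⟩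
  have hr : rk (N ／ ({a} : Set α)) W = rk N W := by
    have h1 := rk_contract_add_one hind hW
    rw [rk_insert_left_eq_add_one_of_seriesPair h hY] at h1
    omega
  have hcompl : (gr N).erase a \ W = (gr N \ W).erase a := by
    ext y
    simp only [mem_sdiff, mem_erase, ne_eq]
    tauto
  have hac : a ∈ gr N \ W := mem_sdiff.2 ⟨ha, haW⟩
  have hZ : (gr N \ W).erase a ⊆ (gr N).erase a :=
    fun y hy => mem_erase.2 ⟨(mem_erase.1 hy).1, (mem_sdiff.1 (mem_of_mem_erase hy)).1⟩
  have hrc : rk (N ／ ({a} : Set α)) ((gr N \ W).erase a) + 1 = rk N (gr N \ W) := by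
    rw [rk_contract_add_one hind hZ, insert_erase hac]
  have hcc : ((gr N \ W).erase a).card + 1 = (gr N \ W).card := by
    rw [card_erase_of_mem hac]
    have := card_pos.2 ⟨a, hac⟩
    omega
  rw [mem_biIndepSets, mem_biIndepSets, hgr, hr, hcompl]
  constructor
  · rintro ⟨_, hc, hr', hcr⟩
    exact ⟨hW.trans (erase_subset _ _), hc, hr', by omega⟩
  · rintro ⟨_, hc, hr', hcr⟩
    exact ⟨hW, hc, hr', by omega⟩

/-- A bi-independent `k`-set of `N ／ a` containing `a'` is the trace of the bi-independent `(k+1)`-set `W + a` of `N`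
(the complements coincide and avoid `a, a'`). -/
theorem mem_biIndepSets_contract_iff_insert_of_seriesPair {a a' : α} (h : SeriesPair N a a') {k : ℕ}
    {W : Finset α} (hW : W ⊆ (gr N).erase a) (ha'W : a' ∈ W) :
    W ∈ biIndepSets (N ／ ({a} : Set α)) k ↔ insert a W ∈ biIndepSets N (k + 1) := by
  have ha : a ∈ gr N := h.1
  have hind := indep_singleton_of_seriesPair h
  have hgr : gr (N ／ ({a} : Set α)) = (gr N).erase a := gr_contract'
  have haW : a ∉ W := fun h' => (mem_erase.1 (hW h')).1 rfl
  have hcompl : (gr N).erase a \ W = gr N \ insert a W := by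
    ext y
    simp only [mem_sdiff, mem_erase, mem_insert, not_or, ne_eq]
    tauto
  have hZ : gr N \ insert a W ⊆ ((gr N).erase a).erase a' := by
    intro y hy
    rw [mem_sdiff, mem_insert, not_or] at hy
    exact mem_erase.2 ⟨fun h' => hy.2.2 (h' ▸ ha'W), mem_erase.2 ⟨hy.2.1, hy.1⟩⟩
  have hZ' : gr N \ insert a W ⊆ (gr N).erase a := hZ.trans (erase_subset _ _)
  have hrc : rk (N ／ ({a} : Set α)) (gr N \ insert a W) = rk N (gr N \ insert a W) := by
    have h1 := rk_contract_add_one hind hZ'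
    rw [rk_insert_left_eq_add_one_of_seriesPair h hZ] at h1
    omega
  have hr := rk_contract_add_one hind hW
  rw [mem_biIndepSets, mem_biIndepSets, hgr, hcompl, hrc, card_insert_of_notMem haW]
  constructor
  · rintro ⟨_, hc, hr', hcr⟩
    exact ⟨insert_subset ha (hW.trans (erase_subset _ _)), by omega, by omega, hcr⟩
  · rintro ⟨_, hc, hr', hcr⟩
    exact ⟨hW, by omega, by omega, hcr⟩

/-! ### The `10`-point minor `N₁ := N ／ a ∖ a'` -/

/-- The ground set of `N ／ a ∖ a'`. -/
theorem gr_minor_of_seriesPair (a a' : α) :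
    gr ((N ／ ({a} : Set α)) ＼ ({a'} : Set α)) = ((gr N).erase a).erase a' := by
  rw [gr_delete', gr_contract']

/-- A bi-independent `k`-set `Y` of the minor `N ／ a ∖ a'` is the trace of the bi-independent `(k+1)`-set `Y + a`
of `N` (`ρ_{N₁}(Y) + 1 = ρ_N(Y + a)`; the complement of `Y + a` in `E` is the complement of `Y` in `E₁` plus `a'`,
of rank one more). -/
theorem mem_biIndepSets_minor_iff_insert_left_of_seriesPair {a a' : α} (h : SeriesPair N a a') {k : ℕ}
    {Y : Finset α} (hY : Y ⊆ ((gr N).erase a).erase a') :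
    Y ∈ biIndepSets ((N ／ ({a} : Set α)) ＼ ({a'} : Set α)) k ↔ insert a Y ∈ biIndepSets N (k + 1) := by
  have ha : a ∈ gr N := h.1
  have ha' : a' ∈ gr N := h.2.1
  have hne : a ≠ a' := h.2.2.1
  have hx1 := rk_singleton_eq_one_of_seriesPair h
  have hgr : gr ((N ／ ({a} : Set α)) ＼ ({a'} : Set α)) = ((gr N).erase a).erase a' :=
    gr_minor_of_seriesPair a a'
  have haY : a ∉ Y := fun h' => (mem_erase.1 (mem_of_mem_erase (hY h'))).1 rfl
  have ha'Y : a' ∉ Y := fun h' => (mem_erase.1 (hY h')).1 rfl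
  have hY' : Y ⊆ gr ((N ／ ({a} : Set α)) ＼ ({a'} : Set α)) := by rw [hgr]; exact hY
  have hr := rk_minor_add_one hx1 hY'
  have hcompl : ((gr N).erase a).erase a' \ Y = (gr N \ insert a Y).erase a' := by
    ext y
    simp only [mem_sdiff, mem_erase, mem_insert, not_or, ne_eq]
    tauto
  have hZ : (gr N \ insert a Y).erase a' ⊆ ((gr N).erase a).erase a' := by
    intro y hy
    rw [mem_erase, mem_sdiff, mem_insert, not_or] at hy
    exact mem_erase.2 ⟨hy.1, mem_erase.2 ⟨hy.2.2.1, hy.2.1⟩⟩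
  have hZ' : (gr N \ insert a Y).erase a' ⊆ gr ((N ／ ({a} : Set α)) ＼ ({a'} : Set α)) := by
    rw [hgr]; exact hZ
  have ha'c : a' ∈ gr N \ insert a Y :=
    mem_sdiff.2 ⟨ha', by rw [mem_insert, not_or]; exact ⟨hne.symm, ha'Y⟩⟩
  have hrc : rk ((N ／ ({a} : Set α)) ＼ ({a'} : Set α)) ((gr N \ insert a Y).erase a') + 1 =
      rk N (gr N \ insert a Y) := by
    rw [rk_minor_add_one hx1 hZ', rk_insert_left_eq_add_one_of_seriesPair h hZ,
      ← rk_insert_right_eq_add_one_of_seriesPair h hZ, insert_erase ha'c]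
  have hcc : ((gr N \ insert a Y).erase a').card + 1 = (gr N \ insert a Y).card := by
    rw [card_erase_of_mem ha'c]
    have := card_pos.2 ⟨a', ha'c⟩
    omega
  rw [mem_biIndepSets, mem_biIndepSets, hgr, hcompl, card_insert_of_notMem haY]
  constructor
  · rintro ⟨_, hc, hr', hcr⟩
    exact ⟨insert_subset ha (hY.trans ((erase_subset _ _).trans (erase_subset _ _))), by omega, by omega,
      by omega⟩
  · rintro ⟨_, hc, hr', hcr⟩
    exact ⟨hY, by omega, by omega, by omega⟩

/-- The same with `a'`: `Y ∈ BI_k(N ／ a ∖ a')` iff `Y + a' ∈ BI_{k+1}(N)` (the swap). -/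
theorem mem_biIndepSets_minor_iff_insert_right_of_seriesPair {a a' : α} (h : SeriesPair N a a') {k : ℕ}
    {Y : Finset α} (hY : Y ⊆ ((gr N).erase a).erase a') :
    Y ∈ biIndepSets ((N ／ ({a} : Set α)) ＼ ({a'} : Set α)) k ↔ insert a' Y ∈ biIndepSets N (k + 1) := by
  have haY : a ∉ Y := fun h' => (mem_erase.1 (mem_of_mem_erase (hY h'))).1 rfl
  have ha'Y : a' ∉ Y := fun h' => (mem_erase.1 (hY h')).1 rfl
  rw [mem_biIndepSets_minor_iff_insert_left_of_seriesPair h hY]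
  exact insert_left_mem_biIndepSets_iff_insert_right_of_seriesPair h haY ha'Y

/-- The rank of the minor `N ／ a ∖ a'`: `ρ(E) − 1` (`a'` is not a coloop of `N`). -/
theorem rk_gr_minor_add_one_of_seriesPair {a a' : α} (h : SeriesPair N a a') :
    rk ((N ／ ({a} : Set α)) ＼ ({a'} : Set α)) (gr ((N ／ ({a} : Set α)) ＼ ({a'} : Set α))) + 1 =
      rk N (gr N) := by
  have hx1 := rk_singleton_eq_one_of_seriesPair h
  rw [rk_minor_add_one hx1 (Subset.refl _), gr_minor_of_seriesPair, insert_erase_erase_eq_erase h.1 h.2.2.1,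
    h.2.2.2.2.1]

/-- The number of points of the minor `N ／ a ∖ a'`: `#E − 2`. -/
theorem card_gr_minor_add_two_of_seriesPair {a a' : α} (h : SeriesPair N a a') :
    (gr ((N ／ ({a} : Set α)) ＼ ({a'} : Set α))).card + 2 = (gr N).card := by
  rw [gr_minor_of_seriesPair, card_erase_of_mem (mem_erase.2 ⟨h.2.2.1.symm, h.2.1⟩), card_erase_of_mem h.1]
  have h2 : 2 ≤ (gr N).card := by
    have := card_le_card (show ({a, a'} : Finset α) ⊆ gr N from
      insert_subset h.1 (singleton_subset_iff.2 h.2.1))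
    rwa [card_pair h.2.2.1] at this
  omega

end TwelveSeriesA

end PercRepro.Cogirth
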